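import Summits.MatrixMultiplication.MatrixMultiplication.Theorems.SoloInformedValNormalForm

/-!
# SoloInformedValFamily — the sign-coherent family: `Val(n) > n + 1` for a 4-parameter family of `n`

Pratt [arXiv:2309.03878 (ITCS 2024), Def. 4.2]: `Val(n)` = the maximum number of solutions of `a + b + c = n` over
equilateral-trapezoid-free `A, B, C ⊆ {0,…,n}`; the star gives `n + 1`.  `SoloInformedValSmall` kernel-checks ONE
member (`Val(232) ≥ 236`) of the soloist's sign-coherent family (gen 68, dossier `paper/val-superlinear.md` §13,
Theorem I) by `omega`.  This file proves the WHOLE FAMILY, with the moduli as variables (so `omega` is replaced by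
three small carry lemmas `quot_zero`, `quot_negone_or_zero`, `no_multiple`):

for integers `b ≥ 2` (bottom modulus), `m ≥ 4` (middle modulus), `p ≥ 2`, `q ≥ 2` (top ranges) and digits
`x x' ∈ [1, b-1]`, `y ∈ [1, m-2]`, `y' ∈ [1, m-1]`, `c ∈ [2, p]`, `z ∈ [2, q]`, the triple

  `X = {b y + x} ∪ {b m z - b y'}`, `Y = {-b m c - b y} ∪ {x' - b m z}`, `Z = {b m c - x} ∪ {b y' - x'}`

(the difference sets `B - A`, `C - B`, `A - C` of the two words `u₁ = (A | B | C) = (-x | y | -c)`,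
`u₂ = (C | A | B) = (x' | y' | z)` at the places of weight `(1 | b | b m)`) is equilateral trapezoid-free for the
target `0` (`trapezoidFree_XYZ`), has at least `(b-1)((m-2)(p-1) + (m-1)(q-1))` solutions (`card_solutions_ge`), and
lies in `X ⊆ [b+1, b m q - b]`, `Y ⊆ [-(b m p + b (m-2)) ⊓ (1 - b m q), b - 1 - 2 b m]`, `Z ⊆ [1, b m p - 1]`
(`X_bound`, `Y_bound`, `Z_bound`); `val_family` translates it into `{0,…,n}` for every
`n ≥ max (b m p + b (m-2)) (b m q - 1) - b - 2` with the target `n`.  Instances: `(b,m,p,q) = (5,6,7,8)` is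
`Val(232) ≥ 236`; `(8,13,k,k+1)` gives `Val(104k+93) ≥ 161k-77`, whose intervals `[n, T-2]` overlap from `k = 5`,
and thirteen further members chain `[261, 612]`: `val_ge_add_two` — for EVERY `n ≥ 261` there are equilateral
trapezoid-free `A, B, C ⊆ {0,…,n}` with at least `n + 2` solutions of `a + b + c = n` (`Val(n) ≥ n + 2 > n + 1`);
`val_ge_add_two_low` adds `232 ≤ n ≤ 253`, `n ≠ 235, 236`.  (Exhaustive search, not in Lean, gives
`Val(n) = n + 1` for `n ≤ 12`; the nine values `235, 236, 254..260` and `13..231` are open to this family.)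

Why no digit needs the hole `{0, ±1}` of `SoloInformedValTrapezoid`: every place sees carries of ONE sign
(`κ ∈ {0,1}`), and each lone digit a carry could cancel has the opposite sign (proof of `tri`, 8 cases).
Standard axioms only.  FILE LAYOUT (400-line lint): this file = carry lemmas, the six digit images, `tri`, digit
uniqueness / disjointness; `SoloInformedValFamilyFree` = the three systems, `trapezoidFree_XYZ`, the solution count;
`SoloInformedValFamilyVal` = bounds, the normal form `val_family`, and the corollaries `val_232'`,
`val_ge_add_two` (every `n ≥ 261`), `val_ge_add_two_low`.
-/

namespace Summit.MatrixMultiplication.MatrixMultiplication.Theorems.SoloVal.Family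

open Finset

/-! ## Carry lemmas (replace `omega` when the modulus is a variable) -/

/-- A multiple of `b > 0` strictly between `-b` and `b` is `0`. -/
theorem quot_zero {b K : ℤ} (hb : 0 < b) (h1 : -b < b * K) (h2 : b * K < b) : K = 0 := by
  rcases lt_trichotomy K 0 with hK | hK | hK
  · nlinarith
  · exact hK
  · nlinarith

/-- A multiple of `b > 0` strictly between `-2b` and `b` is `-b` or `0`. -/
theorem quot_negone_or_zero {b K : ℤ} (hb : 0 < b) (h1 : -(2 * b) < b * K) (h2 : b * K < b) :
    K = -1 ∨ K = 0 := by
  rcases lt_trichotomy K (-1) with hK | hK | hK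
  · exfalso; nlinarith
  · exact Or.inl hK
  · right; exact quot_zero hb (by nlinarith) h2

/-- `2 ≤ c` and `0 ≤ m` give `2 m ≤ m c`. -/
theorem two_mul_le {m c : ℤ} (hm : 0 ≤ m) (hc : 2 ≤ c) : 2 * m ≤ m * c := by nlinarith

section Family

variable (b m p q : ℤ)

/-! ## The six digit images -/

/-- `X₁ = {b y + x : y ∈ [1, m-2], x ∈ [1, b-1]}`. -/
noncomputable def X1 : Finset ℤ := (Icc 1 (m - 2) ×ˢ Icc 1 (b - 1)).image (fun e => b * e.1 + e.2)
/-- `X₂ = {b m z - b y' : z ∈ [2, q], y' ∈ [1, m-1]}`. -/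
noncomputable def X2 : Finset ℤ := (Icc 2 q ×ˢ Icc 1 (m - 1)).image (fun e => b * m * e.1 - b * e.2)
/-- `Y₁ = {-b m c - b y : c ∈ [2, p], y ∈ [1, m-2]}`. -/
noncomputable def Y1 : Finset ℤ := (Icc 2 p ×ˢ Icc 1 (m - 2)).image (fun e => -(b * m * e.1) - b * e.2)
/-- `Y₂ = {x' - b m z : x' ∈ [1, b-1], z ∈ [2, q]}`. -/
noncomputable def Y2 : Finset ℤ := (Icc 1 (b - 1) ×ˢ Icc 2 q).image (fun e => e.1 - b * m * e.2)
/-- `Z₁ = {b m c - x : c ∈ [2, p], x ∈ [1, b-1]}`. -/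
noncomputable def Z1 : Finset ℤ := (Icc 2 p ×ˢ Icc 1 (b - 1)).image (fun e => b * m * e.1 - e.2)
/-- `Z₂ = {b y' - x' : y' ∈ [1, m-1], x' ∈ [1, b-1]}`. -/
noncomputable def Z2 : Finset ℤ := (Icc 1 (m - 1) ×ˢ Icc 1 (b - 1)).image (fun e => b * e.1 - e.2)

/-- `X = X₁ ∪ X₂`. -/
noncomputable def X : Finset ℤ := X1 b m ∪ X2 b m q
/-- `Y = Y₁ ∪ Y₂`. -/
noncomputable def Y : Finset ℤ := Y1 b m p ∪ Y2 b m q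
/-- `Z = Z₁ ∪ Z₂`. -/
noncomputable def Z : Finset ℤ := Z1 b m p ∪ Z2 b m

/-- Membership in an image of a product of two intervals. -/
theorem mem_img {l₁ u₁ l₂ u₂ : ℤ} {f : ℤ → ℤ → ℤ} {v : ℤ} :
    v ∈ (Icc l₁ u₁ ×ˢ Icc l₂ u₂).image (fun e => f e.1 e.2) ↔
      ∃ a c, (l₁ ≤ a ∧ a ≤ u₁) ∧ (l₂ ≤ c ∧ c ≤ u₂) ∧ f a c = v := by
  constructor
  · intro h
    obtain ⟨⟨a, c⟩, hac, rfl⟩ := mem_image.1 h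
    rw [mem_product, mem_Icc, mem_Icc] at hac
    exact ⟨a, c, hac.1, hac.2, rfl⟩
  · rintro ⟨a, c, ha, hc, rfl⟩
    exact mem_image.2 ⟨(a, c), mem_product.2 ⟨mem_Icc.2 ha, mem_Icc.2 hc⟩, rfl⟩

variable {b m p q}

/-- Membership in `X₁`. -/
theorem mem_X1 {v : ℤ} : v ∈ X1 b m ↔ ∃ y x, (1 ≤ y ∧ y ≤ m - 2) ∧ (1 ≤ x ∧ x ≤ b - 1) ∧ b * y + x = v :=
  mem_img (f := fun y x => b * y + x)
/-- Membership in `X₂`. -/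
theorem mem_X2 {v : ℤ} : v ∈ X2 b m q ↔ ∃ z y, (2 ≤ z ∧ z ≤ q) ∧ (1 ≤ y ∧ y ≤ m - 1) ∧ b * m * z - b * y = v :=
  mem_img (f := fun z y => b * m * z - b * y)
/-- Membership in `Y₁`. -/
theorem mem_Y1 {v : ℤ} : v ∈ Y1 b m p ↔ ∃ c y, (2 ≤ c ∧ c ≤ p) ∧ (1 ≤ y ∧ y ≤ m - 2) ∧ -(b * m * c) - b * y = v :=
  mem_img (f := fun c y => -(b * m * c) - b * y)
/-- Membership in `Y₂`. -/
theorem mem_Y2 {v : ℤ} : v ∈ Y2 b m q ↔ ∃ x z, (1 ≤ x ∧ x ≤ b - 1) ∧ (2 ≤ z ∧ z ≤ q) ∧ x - b * m * z = v :=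
  mem_img (f := fun x z => x - b * m * z)
/-- Membership in `Z₁`. -/
theorem mem_Z1 {v : ℤ} : v ∈ Z1 b m p ↔ ∃ c x, (2 ≤ c ∧ c ≤ p) ∧ (1 ≤ x ∧ x ≤ b - 1) ∧ b * m * c - x = v :=
  mem_img (f := fun c x => b * m * c - x)
/-- Membership in `Z₂`. -/
theorem mem_Z2 {v : ℤ} : v ∈ Z2 b m ↔ ∃ y x, (1 ≤ y ∧ y ≤ m - 1) ∧ (1 ≤ x ∧ x ≤ b - 1) ∧ b * y - x = v :=
  mem_img (f := fun y x => b * y - x)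

/-! ## The solution equation forces an intended pattern -/

/-- `u + v + w = 0` on `X × Y × Z` forces one of the two intended digit patterns (8 cases; carries by hand). -/
theorem tri (hb : 2 ≤ b) (hm : 4 ≤ m) {u v w : ℤ} (hu : u ∈ X b m q) (hv : v ∈ Y b m p q) (hw : w ∈ Z b m p)
    (h : u + v + w = 0) :
    (∃ x y c, (1 ≤ x ∧ x ≤ b - 1) ∧ (1 ≤ y ∧ y ≤ m - 2) ∧ (2 ≤ c ∧ c ≤ p) ∧
        u = b * y + x ∧ v = -(b * m * c) - b * y ∧ w = b * m * c - x) ∨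
    (∃ x y z, (1 ≤ x ∧ x ≤ b - 1) ∧ (1 ≤ y ∧ y ≤ m - 1) ∧ (2 ≤ z ∧ z ≤ q) ∧
        u = b * m * z - b * y ∧ v = x - b * m * z ∧ w = b * y - x) := by
  have hb0 : 0 < b := by omega
  have hm0 : 0 < m := by omega
  simp only [X, Y, Z, mem_union, mem_X1, mem_X2, mem_Y1, mem_Y2, mem_Z1, mem_Z2] at hu hv hw
  rcases hu with ⟨y1, x1, hy1, hx1, rfl⟩ | ⟨z1, y1, hz1, hy1, rfl⟩ <;>
  rcases hv with ⟨c2, y2, hc2, hy2, rfl⟩ | ⟨x2, z2, hx2, hz2, rfl⟩ <;>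
  rcases hw with ⟨c3, x3, hc3, hx3, rfl⟩ | ⟨y3, x3, hy3, hx3, rfl⟩
  -- (X₁,Y₁,Z₁): intended pattern 1
  · have hK : b * (y1 - y2 + m * (c3 - c2)) = x3 - x1 := by linear_combination h
    have K0 := quot_zero hb0 (by rw [hK]; omega) (by rw [hK]; omega)
    have hJ : m * (c3 - c2) = y2 - y1 := by linear_combination K0
    have J0 := quot_zero hm0 (by rw [hJ]; omega) (by rw [hJ]; omega)
    have e1 : c3 = c2 := by omega
    have e2 : y2 = y1 := by rw [e1, sub_self, mul_zero] at hJ; omega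
    have e3 : x3 = x1 := by rw [e1, e2, sub_self, sub_self, mul_zero, add_zero, mul_zero] at hK; omega
    exact Or.inl ⟨x1, y1, c2, hx1, hy1, hc2, rfl, by rw [e2], by rw [e1, e3]⟩
  -- (X₁,Y₁,Z₂): K = 0, then m c₂ = y₁ - y₂ + y₃ ≤ 2m - 4 < 2m ≤ m c₂
  · have hK : b * (y1 - y2 + y3 - m * c2) = x3 - x1 := by linear_combination h
    have K0 := quot_zero hb0 (by rw [hK]; omega) (by rw [hK]; omega)
    have := two_mul_le hm0.le hc2.1
    exfalso; omega
  -- (X₁,Y₂,Z₁): K ∈ {-1,0}, then m (c₃ - z₂) = K - y₁ ∈ [1-m, -1]: no multiple of m there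
  · have hK : b * (y1 + m * (c3 - z2)) = x3 - x1 - x2 := by linear_combination h
    have K01 := quot_negone_or_zero hb0 (by rw [hK]; omega) (by rw [hK]; omega)
    have hJ : m * (c3 - z2) = (y1 + m * (c3 - z2)) - y1 := by ring
    exfalso
    rcases K01 with e | e <;> rw [e] at hJ
    · have := quot_zero hm0 (K := c3 - z2) (by rw [hJ]; omega) (by rw [hJ]; omega)
      rw [this, mul_zero] at hJ; omega
    · have := quot_zero hm0 (K := c3 - z2) (by rw [hJ]; omega) (by rw [hJ]; omega)
      rw [this, mul_zero] at hJ; omega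
  -- (X₁,Y₂,Z₂): K ∈ {-1,0}, then m z₂ = y₁ + y₃ - K ≤ 2m - 2 < 2m ≤ m z₂
  · have hK : b * (y1 + y3 - m * z2) = x3 - x1 - x2 := by linear_combination h
    have K01 := quot_negone_or_zero hb0 (by rw [hK]; omega) (by rw [hK]; omega)
    have := two_mul_le hm0.le hz2.1
    exfalso; rcases K01 with e | e <;> omega
  -- (X₂,Y₁,Z₁): bottom digit -x₃ alone: b K = x₃ ∈ (0, b)
  · have hK : b * (m * z1 - y1 - m * c2 - y2 + m * c3) = x3 := by linear_combination h
    have K0 := quot_zero hb0 (by rw [hK]; omega) (by rw [hK]; omega)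
    rw [K0, mul_zero] at hK; exfalso; omega
  -- (X₂,Y₁,Z₂): same
  · have hK : b * (m * z1 - y1 - m * c2 - y2 + y3) = x3 := by linear_combination h
    have K0 := quot_zero hb0 (by rw [hK]; omega) (by rw [hK]; omega)
    rw [K0, mul_zero] at hK; exfalso; omega
  -- (X₂,Y₂,Z₁): K = 0, then m (z₁ - z₂ + c₃) = y₁ ∈ (0, m)
  · have hK : b * (m * (z1 - z2 + c3) - y1) = x3 - x2 := by linear_combination h
    have K0 := quot_zero hb0 (by rw [hK]; omega) (by rw [hK]; omega)
    have hJ : m * (z1 - z2 + c3) = y1 := by linear_combination K0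
    have := quot_zero hm0 (K := z1 - z2 + c3) (by rw [hJ]; omega) (by rw [hJ]; omega)
    rw [this, mul_zero] at hJ; exfalso; omega
  -- (X₂,Y₂,Z₂): intended pattern 2
  · have hK : b * (m * (z1 - z2) + y3 - y1) = x3 - x2 := by linear_combination h
    have K0 := quot_zero hb0 (by rw [hK]; omega) (by rw [hK]; omega)
    have hJ : m * (z1 - z2) = y1 - y3 := by linear_combination K0
    have J0 := quot_zero hm0 (by rw [hJ]; omega) (by rw [hJ]; omega)
    have e1 : z2 = z1 := by omega
    have e2 : y3 = y1 := by rw [e1, sub_self, mul_zero] at hJ; omega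
    have e3 : x3 = x2 := by rw [e1, e2, sub_self, mul_zero, zero_add, sub_self, mul_zero] at hK; omega
    exact Or.inr ⟨x2, y1, z1, hx2, hy1, hz1, rfl, by rw [e1], by rw [e2, e3]⟩

/-! ## Uniqueness of digits inside a word, and disjointness across words -/

/-- `X₁`: `b y + x` determines `(y, x)`. -/
theorem U_X1 (hb : 0 < b) {y x y' x' : ℤ} (hx : 1 ≤ x ∧ x ≤ b - 1) (hx' : 1 ≤ x' ∧ x' ≤ b - 1)
    (h : b * y + x = b * y' + x') : y = y' ∧ x = x' := by
  have hK : b * (y - y') = x' - x := by linear_combination h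
  have K0 := quot_zero hb (by rw [hK]; omega) (by rw [hK]; omega)
  rw [K0, mul_zero] at hK
  constructor <;> omega

/-- `Z₂`: `b y - x` determines `(y, x)`. -/
theorem U_Z2 (hb : 0 < b) {y x y' x' : ℤ} (hx : 1 ≤ x ∧ x ≤ b - 1) (hx' : 1 ≤ x' ∧ x' ≤ b - 1)
    (h : b * y - x = b * y' - x') : y = y' ∧ x = x' := by
  have hK : b * (y - y') = x - x' := by linear_combination h
  have K0 := quot_zero hb (by rw [hK]; omega) (by rw [hK]; omega)
  rw [K0, mul_zero] at hK
  constructor <;> omega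

/-- `X₂`: `b m z - b y` determines `(z, y)` for `y, y' ∈ [1, m-1]`. -/
theorem U_X2 (hb : 0 < b) (hm : 0 < m) {z y z' y' : ℤ} (hy : 1 ≤ y ∧ y ≤ m - 1) (hy' : 1 ≤ y' ∧ y' ≤ m - 1)
    (h : b * m * z - b * y = b * m * z' - b * y') : z = z' ∧ y = y' := by
  have hK : b * (m * (z - z') - (y - y')) = 0 := by linear_combination h
  have K0 := quot_zero hb (by rw [hK]; omega) (by rw [hK]; omega)
  have hJ : m * (z - z') = y - y' := by linear_combination K0
  have J0 := quot_zero hm (by rw [hJ]; omega) (by rw [hJ]; omega)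
  rw [J0, mul_zero] at hJ
  constructor <;> omega

/-- `Y₁`: `-(b m c) - b y` determines `(c, y)` for `y, y' ∈ [1, m-2]`. -/
theorem U_Y1 (hb : 0 < b) (hm : 0 < m) {c y c' y' : ℤ} (hy : 1 ≤ y ∧ y ≤ m - 2) (hy' : 1 ≤ y' ∧ y' ≤ m - 2)
    (h : -(b * m * c) - b * y = -(b * m * c') - b * y') : c = c' ∧ y = y' := by
  have hK : b * (m * (c' - c) - (y - y')) = 0 := by linear_combination h
  have K0 := quot_zero hb (by rw [hK]; omega) (by rw [hK]; omega)
  have hJ : m * (c' - c) = y - y' := by linear_combination K0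
  have J0 := quot_zero hm (by rw [hJ]; omega) (by rw [hJ]; omega)
  rw [J0, mul_zero] at hJ
  constructor <;> omega

/-- `Y₂`: `x - b m z` determines `(x, z)` for `x, x' ∈ [1, b-1]`. -/
theorem U_Y2 (hb : 0 < b) (hm : 0 < m) {x z x' z' : ℤ} (hx : 1 ≤ x ∧ x ≤ b - 1) (hx' : 1 ≤ x' ∧ x' ≤ b - 1)
    (h : x - b * m * z = x' - b * m * z') : x = x' ∧ z = z' := by
  have hK : b * (m * (z' - z)) = x' - x := by linear_combination h
  have K0 := quot_zero hb (by rw [hK]; omega) (by rw [hK]; omega)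
  have J0 := quot_zero hm (K := z' - z) (by rw [K0]; omega) (by rw [K0]; omega)
  rw [K0] at hK
  constructor <;> omega

/-- `Z₁`: `b m c - x` determines `(c, x)` for `x, x' ∈ [1, b-1]`. -/
theorem U_Z1 (hb : 0 < b) (hm : 0 < m) {c x c' x' : ℤ} (hx : 1 ≤ x ∧ x ≤ b - 1) (hx' : 1 ≤ x' ∧ x' ≤ b - 1)
    (h : b * m * c - x = b * m * c' - x') : c = c' ∧ x = x' := by
  have hK : b * (m * (c - c')) = x - x' := by linear_combination h
  have K0 := quot_zero hb (by rw [hK]; omega) (by rw [hK]; omega)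
  have J0 := quot_zero hm (K := c - c') (by rw [K0]; omega) (by rw [K0]; omega)
  rw [K0] at hK
  constructor <;> omega

/-- `X₁ ∩ X₂ = ∅` and `Y₁ ∩ Y₂ = ∅`: `b K = x` is impossible for `x ∈ [1, b-1]`. -/
theorem D_bot (hb : 0 < b) {x K : ℤ} (hx : 1 ≤ x ∧ x ≤ b - 1) (h : b * K = x) : False := by
  have K0 := quot_zero hb (by rw [h]; omega) (by rw [h]; omega)
  rw [K0, mul_zero] at h; omega

/-- `Z₁ ∩ Z₂ = ∅`: `b m c - x = b y' - x'` is impossible (`y' < m ≤ m c`). -/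
theorem D_Z (hb : 0 < b) (hm : 0 < m) {c x y' x' : ℤ} (hc : 2 ≤ c) (hx : 1 ≤ x ∧ x ≤ b - 1) (hx' : 1 ≤ x' ∧ x' ≤ b - 1)
    (hy' : 1 ≤ y' ∧ y' ≤ m - 1) (h : b * m * c - x = b * y' - x') : False := by
  have hK : b * (m * c - y') = x - x' := by linear_combination h
  have K0 := quot_zero hb (by rw [hK]; omega) (by rw [hK]; omega)
  have := two_mul_le hm.le hc
  omega

end Family

end Summit.MatrixMultiplication.MatrixMultiplication.Theorems.SoloVal.Family
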